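import Mathlib.Analysis.SpecialFunctions.Pow.Real
import HarnessLib

/-!
# Rational certificates for real powers `t^α ≤ R` / `R ≤ t^α` at the lane's irrational exponents
(lane prim-rate, constants-miner 1, gen 28; RIGOROUS-CERTIFICATION.md §1 «TANGENT ROWS», NEXT-g27 item 2 (ii), NEXT-g28 item 2)

Support file for the closed crux `NoHeavyLowerTail` (stmt-CriticalPhenomena-4575), majority-gluing line; companion of
`…MajorityGluingConvexBootstrapTangent` (validity of the outward-rounded Kelley rows GIVEN real inequalities
`C·(a·b)^q·(1−2q) ≤ h`, `C·q·(a·b)^q/a ≤ g₁`, …) and `…MajorityGluingTypeTableLPCert` (the LP dual check).  The constants of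
the window programmes are products of RATIONAL bases raised to the programme's IRRATIONAL algebraic exponents
(`q₃ = 1/c₃ = 2/(3+√3)`, `b₃/c₃ = 2 − √3`, `p = 1/c₄ = 2/(3+√(11/3))`, `κ₀ = (4 − c₄)/c₄`, …) at rational support
points.  A kernel replay must bound such numbers by rationals WITHOUT evaluating a real power.  This file supplies the
format: monotonicity of `t ↦ t^α` in the exponent (antitone for `t ≤ 1`, monotone for `t ≥ 1`) reduces `t^α ≤ R` to
`t^{a/b} ≤ R` for a rational bracket `a/b` of `α` on the correct side, and `t^{a/b} ≤ R ⟺ t^a ≤ R^b` is an identity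
of rational numbers, decidable by `norm_num` / `decide` on explicit data (`rpow_le_cert`, `rpow_ge_cert`); the root
form of a power row (`root_le_of_rpow_le`); twelve-digit brackets of `√3`, `√(11/3)` and of the four exponents above;
and the monotone assembly of the rounded tangent constants (`tangent_consts_two`).  Real arithmetic only; no sorries.
[cite: VandenbergHaggstromKahn2005, Thm. 1.3 (p. 6)]
-/

namespace Summit.CriticalPhenomena.PercolationContinuityZ3.Theorems

namespace HubOnly
namespace RpowCert

/-! ### The certificate format for `t^α ≤ R` and `R ≤ t^α` -/

/-- `t^{a/b} ≤ R` from the rational identity `t^a ≤ R^b` (`t, R > 0`, `b ≠ 0`). -/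
theorem rpow_div_le_of_pow_le {t R : ℚ} {a : ℤ} {b : ℕ} (ht : 0 < t) (hR : 0 < R) (hb : b ≠ 0)
    (hab : t ^ a ≤ R ^ b) : (t : ℝ) ^ ((a : ℝ) / b) ≤ (R : ℝ) := by
  have htR : (0 : ℝ) < (t : ℝ) := by exact_mod_cast ht
  have hRR : (0 : ℝ) ≤ (R : ℝ) := by exact_mod_cast hR.le
  have hu : 0 ≤ (t : ℝ) ^ ((a : ℝ) / b) := Real.rpow_nonneg htR.le _
  refine le_of_pow_le_pow_left₀ hb hRR ?_
  have e : ((t : ℝ) ^ ((a : ℝ) / b)) ^ b = (t : ℝ) ^ (a : ℤ) := by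
    rw [← Real.rpow_natCast, ← Real.rpow_mul htR.le, div_mul_cancel₀ _ (by exact_mod_cast hb),
      Real.rpow_intCast]
  rw [e]
  have h := hab
  have : ((t ^ a : ℚ) : ℝ) ≤ ((R ^ b : ℚ) : ℝ) := by exact_mod_cast h
  simpa [Rat.cast_zpow, Rat.cast_pow] using this

/-- `R ≤ t^{a/b}` from the rational identity `R^b ≤ t^a` (`t > 0`, `R ≥ 0`, `b ≠ 0`). -/
theorem le_rpow_div_of_pow_le {t R : ℚ} {a : ℤ} {b : ℕ} (ht : 0 < t) (hb : b ≠ 0)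
    (hab : R ^ b ≤ t ^ a) : (R : ℝ) ≤ (t : ℝ) ^ ((a : ℝ) / b) := by
  have htR : (0 : ℝ) < (t : ℝ) := by exact_mod_cast ht
  have hu : 0 ≤ (t : ℝ) ^ ((a : ℝ) / b) := Real.rpow_nonneg htR.le _
  refine le_of_pow_le_pow_left₀ hb hu ?_
  have e : ((t : ℝ) ^ ((a : ℝ) / b)) ^ b = (t : ℝ) ^ (a : ℤ) := by
    rw [← Real.rpow_natCast, ← Real.rpow_mul htR.le, div_mul_cancel₀ _ (by exact_mod_cast hb),
      Real.rpow_intCast]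
  rw [e]
  have : ((R ^ b : ℚ) : ℝ) ≤ ((t ^ a : ℚ) : ℝ) := by exact_mod_cast hab
  simpa [Rat.cast_zpow, Rat.cast_pow] using this

/-- **Upper certificate.**  `t^α ≤ R` for rational `t, R > 0` and a real exponent `α`, from a rational bracket `a/b`
on the correct side (`a/b ≤ α` if `t ≤ 1`, where `t^·` is antitone; `α ≤ a/b` if `1 ≤ t`) and the rational
identity `t^a ≤ R^b`. -/
theorem rpow_le_cert {t R : ℚ} {α : ℝ} {a : ℤ} {b : ℕ} (ht : 0 < t) (hR : 0 < R) (hb : b ≠ 0)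
    (hside : (t ≤ 1 ∧ (a : ℝ) / b ≤ α) ∨ (1 ≤ t ∧ α ≤ (a : ℝ) / b)) (hab : t ^ a ≤ R ^ b) :
    (t : ℝ) ^ α ≤ (R : ℝ) := by
  have htR : (0 : ℝ) < (t : ℝ) := by exact_mod_cast ht
  refine le_trans ?_ (rpow_div_le_of_pow_le ht hR hb hab)
  rcases hside with ⟨h1, hα⟩ | ⟨h1, hα⟩
  · exact Real.rpow_le_rpow_of_exponent_ge htR (by exact_mod_cast h1) hα
  · exact Real.rpow_le_rpow_of_exponent_le (by exact_mod_cast h1) hα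

/-- **Lower certificate.**  `R ≤ t^α` from a bracket on the other side (`α ≤ a/b` if `t ≤ 1`; `a/b ≤ α` if `1 ≤ t`)
and `R^b ≤ t^a`. -/
theorem rpow_ge_cert {t R : ℚ} {α : ℝ} {a : ℤ} {b : ℕ} (ht : 0 < t) (hb : b ≠ 0)
    (hside : (t ≤ 1 ∧ α ≤ (a : ℝ) / b) ∨ (1 ≤ t ∧ (a : ℝ) / b ≤ α)) (hab : R ^ b ≤ t ^ a) :
    (R : ℝ) ≤ (t : ℝ) ^ α := by
  have htR : (0 : ℝ) < (t : ℝ) := by exact_mod_cast ht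
  refine le_trans (le_rpow_div_of_pow_le ht hb hab) ?_
  rcases hside with ⟨h1, hα⟩ | ⟨h1, hα⟩
  · exact Real.rpow_le_rpow_of_exponent_ge htR (by exact_mod_cast h1) hα
  · exact Real.rpow_le_rpow_of_exponent_le (by exact_mod_cast h1) hα

/-- Products: `0 ≤ u ≤ U`, `0 ≤ v ≤ V` give `u·v ≤ U·V` (assembly of a certified constant from certified factors). -/
theorem mul_le_cert {u v U V : ℝ} (hu : 0 ≤ u) (huU : u ≤ U) (hv : 0 ≤ v) (hvV : v ≤ V) : u * v ≤ U * V :=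
  mul_le_mul huU hvV hv (hu.trans huU)

/-! ### The root form of a power row -/

/-- Root extraction: `0 ≤ u`, `0 < c`, `u^c ≤ X` ⟹ `u ≤ X^{1/c}`. -/
theorem le_rpow_inv {u X c : ℝ} (hu : 0 ≤ u) (hc : 0 < c) (h : u ^ c ≤ X) : u ≤ X ^ c⁻¹ := by
  have hX : 0 ≤ X := (Real.rpow_nonneg hu c).trans h
  calc u = (u ^ c) ^ c⁻¹ := (Real.rpow_rpow_inv hu (ne_of_gt hc)).symm
    _ ≤ X ^ c⁻¹ := Real.rpow_le_rpow (Real.rpow_nonneg hu c) h (inv_nonneg.mpr hc.le)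

/-- **Root form of a two-support power row.**  `u^c ≤ K·(s·t)` with `u, K, s, t ≥ 0`, `c > 0` gives
`u ≤ K^{1/c}·(s·t)^{1/c}` — the shape `C·(s·t)^q` of `ConvexBootstrap.tangent_two_rounded` (hub ISO₃: `c = c₃`,
`K = M^{3−c₃}·ρ₀ ≤ M^{3−c₃}`; relay ISO₃ with one support bounded: `K = M^{3−c₃}·B`). -/
theorem root_le_of_rpow_le {u K s t c : ℝ} (hu : 0 ≤ u) (hK : 0 ≤ K) (hs : 0 ≤ s) (ht : 0 ≤ t) (hc : 0 < c)
    (h : u ^ c ≤ K * (s * t)) : u ≤ K ^ c⁻¹ * (s * t) ^ c⁻¹ := by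
  have h1 := le_rpow_inv hu hc h
  rwa [Real.mul_rpow hK (mul_nonneg hs ht)] at h1

/-- Weakening the constant of a power row: `u^c ≤ K·P`, `K ≤ K'`, `P ≥ 0` ⟹ `u^c ≤ K'·P` (e.g. `ρ₀ ≤ 1`, a support
replaced by its certified cell bound). -/
theorem rpow_row_mono {u K K' P c : ℝ} (h : u ^ c ≤ K * P) (hK : K ≤ K') (hP : 0 ≤ P) : u ^ c ≤ K' * P :=
  h.trans (mul_le_mul_of_nonneg_right hK hP)

/-! ### Brackets of the lane's irrational constants (twelve digits) -/

/-- `√3 ∈ (1.732050807568, 1.732050807569)`. -/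
theorem sqrt3_bounds : (1732050807568 : ℝ) / 10 ^ 12 < Real.sqrt 3 ∧ Real.sqrt 3 < 1732050807569 / 10 ^ 12 := by
  constructor
  · rw [Real.lt_sqrt (by norm_num)]; norm_num
  · rw [Real.sqrt_lt' (by norm_num)]; norm_num

/-- `√(11/3) ∈ (1.914854215512, 1.914854215513)`. -/
theorem sqrt_11_3_bounds : (1914854215512 : ℝ) / 10 ^ 12 < Real.sqrt (11 / 3) ∧
    Real.sqrt (11 / 3) < 1914854215513 / 10 ^ 12 := by
  constructor
  · rw [Real.lt_sqrt (by norm_num)]; norm_num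
  · rw [Real.sqrt_lt' (by norm_num)]; norm_num

/-- `b₃/c₃ = (3 − c₃)/c₃ = 2 − √3 ∈ (0.267949192431, 0.267949192432)` — the hub/relay ISO₃ constant `M^{2−√3}`
(the identity `(3 − c₃)/c₃ = 2 − √3` is `ConvexBootstrap.b3_div_c3` of `…ConvexBootstrapCore`). -/
theorem two_sub_sqrt3_bounds : (267949192431 : ℝ) / 10 ^ 12 < 2 - Real.sqrt 3 ∧
    2 - Real.sqrt 3 < 267949192432 / 10 ^ 12 := by
  obtain ⟨h1, h2⟩ := sqrt3_bounds
  constructor <;> linarith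

/-- `q₃ = 1/c₃ = ((3+√3)/2)⁻¹ ∈ (0.422649730810, 0.422649730811)`. -/
theorem inv_c3_bounds : (422649730810 : ℝ) / 10 ^ 12 < ((3 + Real.sqrt 3) / 2)⁻¹ ∧
    ((3 + Real.sqrt 3) / 2)⁻¹ < 422649730811 / 10 ^ 12 := by
  obtain ⟨h1, h2⟩ := sqrt3_bounds
  have hc : 0 < (3 + Real.sqrt 3) / 2 := by linarith
  have e : ((3 + Real.sqrt 3) / 2)⁻¹ = 1 - Real.sqrt 3 / 3 := by
    have h3 : Real.sqrt 3 * Real.sqrt 3 = 3 := Real.mul_self_sqrt (by norm_num)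
    have hm : (1 - Real.sqrt 3 / 3) * ((3 + Real.sqrt 3) / 2) = 1 := by linear_combination (-1 / 6 : ℝ) * h3
    exact inv_eq_of_mul_eq_one_left hm
  rw [e]
  constructor <;> linarith

/-- `p = 1/c₄ = ((3+√(11/3))/2)⁻¹ ∈ (0.406929669182, 0.406929669183)`. -/
theorem inv_c4_bounds : (406929669182 : ℝ) / 10 ^ 12 < ((3 + Real.sqrt (11 / 3)) / 2)⁻¹ ∧
    ((3 + Real.sqrt (11 / 3)) / 2)⁻¹ < 406929669183 / 10 ^ 12 := by
  obtain ⟨h1, h2⟩ := sqrt_11_3_bounds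
  have hc : 0 < (3 + Real.sqrt (11 / 3)) / 2 := by linarith
  constructor
  · rw [lt_inv_comm₀ (by norm_num) hc]
    have : (3 + Real.sqrt (11 / 3)) / 2 < 2457427107757 / 10 ^ 12 := by linarith
    refine lt_trans this ?_
    norm_num
  · rw [inv_lt_comm₀ hc (by norm_num)]
    have : (2457427107755 : ℝ) / 10 ^ 12 < (3 + Real.sqrt (11 / 3)) / 2 := by linarith
    refine lt_trans ?_ this
    norm_num

/-- `κ₀ = (4 − c₄)/c₄ = 4p − 1 ∈ (0.627718676728, 0.627718676732)` — the ISO₄ constant `M^{κ₀}`. -/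
theorem kappa0_bounds :
    (627718676728 : ℝ) / 10 ^ 12 < (4 - (3 + Real.sqrt (11 / 3)) / 2) / ((3 + Real.sqrt (11 / 3)) / 2) ∧
    (4 - (3 + Real.sqrt (11 / 3)) / 2) / ((3 + Real.sqrt (11 / 3)) / 2) < 627718676732 / 10 ^ 12 := by
  obtain ⟨h1, h2⟩ := inv_c4_bounds
  have hc : 0 < (3 + Real.sqrt (11 / 3)) / 2 := by
    have := sqrt_11_3_bounds.1; linarith
  have e : (4 - (3 + Real.sqrt (11 / 3)) / 2) / ((3 + Real.sqrt (11 / 3)) / 2) =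
      4 * ((3 + Real.sqrt (11 / 3)) / 2)⁻¹ - 1 := by
    field_simp
  rw [e]
  constructor <;> linarith

/-! ### Assembly of the rounded tangent constants -/

/-- **The constants of a rounded two-support tangent row.**  If `0 ≤ C ≤ Cu`, `0 ≤ P ≤ Pu` (`P = (a·b)^q` at the
support point), `ql ≤ q ≤ qu` with `2·qu ≤ 1`, `0 ≤ ql` and `a, b > 0`, then the emitted rationals
`h ≥ Cu·Pu·(1 − 2·ql)`, `g₁ ≥ Cu·qu·Pu/a`, `g₂ ≥ Cu·qu·Pu/b` dominate the true tangent data — the hypotheses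
`hh, hg₁, hg₂` of `ConvexBootstrap.tangent_two_rounded`. -/
theorem tangent_consts_two {C Cu P Pu q ql qu a b h g₁ g₂ : ℝ} (hC : 0 ≤ C) (hCu : C ≤ Cu) (hP : 0 ≤ P)
    (hPu : P ≤ Pu) (hql : ql ≤ q) (hqu : q ≤ qu) (hqu1 : 2 * qu ≤ 1) (hql0 : 0 ≤ ql) (ha : 0 < a) (hb : 0 < b)
    (hh : Cu * Pu * (1 - 2 * ql) ≤ h) (hg₁ : Cu * qu * Pu / a ≤ g₁) (hg₂ : Cu * qu * Pu / b ≤ g₂) :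
    C * P * (1 - 2 * q) ≤ h ∧ C * q * P / a ≤ g₁ ∧ C * q * P / b ≤ g₂ := by
  have hCP : C * P ≤ Cu * Pu := mul_le_cert hC hCu hP hPu
  have hCP0 : 0 ≤ C * P := mul_nonneg hC hP
  have hq0 : 0 ≤ q := hql0.trans hql
  have h12 : 0 ≤ 1 - 2 * q := by linarith
  refine ⟨?_, ?_, ?_⟩
  · calc C * P * (1 - 2 * q) ≤ Cu * Pu * (1 - 2 * q) := mul_le_mul_of_nonneg_right hCP h12
      _ ≤ Cu * Pu * (1 - 2 * ql) := by
          have : 0 ≤ Cu * Pu := hCP0.trans hCP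
          nlinarith
      _ ≤ h := hh
  · have hnum : C * q * P ≤ Cu * qu * Pu := by
      have e1 : C * q * P = (C * P) * q := by ring
      have e2 : Cu * qu * Pu = (Cu * Pu) * qu := by ring
      rw [e1, e2]
      exact mul_le_cert hCP0 hCP hq0 hqu
    exact (div_le_div_of_nonneg_right hnum ha.le).trans hg₁
  · have hnum : C * q * P ≤ Cu * qu * Pu := by
      have e1 : C * q * P = (C * P) * q := by ring
      have e2 : Cu * qu * Pu = (Cu * Pu) * qu := by ring
      rw [e1, e2]
      exact mul_le_cert hCP0 hCP hq0 hqu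
    exact (div_le_div_of_nonneg_right hnum hb.le).trans hg₂

/-! ### Smoke tests of the format -/

/-- Smoke test of the format on the hub ISO₃ constant at the top of the window: `(13/256)^{2−√3} ≤ 9/20`
(true value `0.44998…`) via the continued-fraction bracket `209/780 ≤ 2 − √3` (base `≤ 1`: bracket from below) and
the rational identity `(13/256)^{209} ≤ (9/20)^{780}`. -/
theorem smoke_hub_constant : (((13 : ℚ) / 256 : ℚ) : ℝ) ^ (2 - Real.sqrt 3) ≤ (((9 : ℚ) / 20 : ℚ) : ℝ) := by
  refine rpow_le_cert (a := 209) (b := 780) (by norm_num) (by norm_num) (by norm_num) (Or.inl ⟨by norm_num, ?_⟩) ?_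
  · have := two_sub_sqrt3_bounds.1
    have h : ((209 : ℤ) : ℝ) / ((780 : ℕ) : ℝ) ≤ 267949192431 / 10 ^ 12 := by norm_num
    linarith
  · decide +kernel

end RpowCert
end HubOnly

end Summit.CriticalPhenomena.PercolationContinuityZ3.Theorems
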